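import Mathlib
import Summits.Ventures.PercRepro.TriangleCapEqualityLocusTriangleFree

/-!
# PercRepro — THE AVOID COUNT: the edges containing neither end of an edge, and the disjoint pairs of a
triangle-free graph off a vertex of maximum degree (p3, gen 42; part 183)

`nonIncident(v, w)` is the number of edges containing neither `v` nor `w`; on an edge `v w` the deficit form of the
edge count reads `d(v) + d(w) + nonIncident(v, w) = r + 1` (`deg_add_deg_add_nonIncident`), so the ordered adjacent pairs
carry `Σ (d(v) + d(w)) + Σ nonIncident = 2 r (r + 1)` (`sum_adjPairsAll_nonIncident_eq`).  In a triangle-free graph an edge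
`x y` off a vertex `v₀` contains at most one neighbour of `v₀`, hence avoids at least `Δ − 1` of the edges at
`v₀` (`nonIncident_ge_of_off`), and summed over the neighbours of `v₀` the same disjoint pairs give
`Σ_{u ∼ v₀} nonIncident(v₀, u) ≥ s (Δ − 1)`, `s` the edges off `v₀` (`sum_nonIncident_at_ge`); the ordered pairs off `v₀`
number `2 s` (`card_adjPairs_off_vertex`) and the pairs at `v₀` carry `2 Σ_{u ∼ v₀} nonIncident(v₀, u)` (`sum_nonIncident_at_eq`).
Part 184 turns this into the stability of the pair count.  Axioms: standard.
-/

namespace PercRepro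

namespace TriangleCap

namespace C047

open Finset

variable {V : Type*} [Fintype V] [DecidableEq V]

/-- The edges containing neither `v` nor `w`. -/
def nonIncident (H : SimpleGraph V) [DecidableRel H.Adj] (v w : V) : ℕ :=
  (H.edgeFinset.filter (fun e => v ∉ e ∧ w ∉ e)).card

/-- `nonIncident` is symmetric. -/
theorem nonIncident_comm (H : SimpleGraph V) [DecidableRel H.Adj] (v w : V) : nonIncident H v w = nonIncident H w v := by
  unfold nonIncident
  congr 1
  ext e
  simp only [mem_filter]
  tauto

/-- **THE DEFICIT FORM OF THE EDGE COUNT:** on an edge `v w`, `d(v) + d(w) + nonIncident(v, w) = r + 1`. -/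
theorem deg_add_deg_add_nonIncident (H : SimpleGraph V) [DecidableRel H.Adj] {v w : V} (h : H.Adj v w) :
    deg H v + deg H w + nonIncident H v w = H.edgeFinset.card + 1 := by
  have h1 := card_union_add_card_inter (H.incidenceFinset v) (H.incidenceFinset w)
  rw [incidenceFinset_inter_of_adj H h, card_singleton] at h1
  have h2 : H.incidenceFinset v ∪ H.incidenceFinset w = H.edgeFinset.filter (fun e => v ∈ e ∨ w ∈ e) := by
    ext e
    simp only [mem_union, SimpleGraph.mem_incidenceFinset, mem_filter, SimpleGraph.mem_edgeFinset]
    change (e ∈ H.edgeSet ∧ v ∈ e) ∨ (e ∈ H.edgeSet ∧ w ∈ e) ↔ _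
    tauto
  have h3 := card_filter_add_card_filter_not (s := H.edgeFinset) (fun e => v ∈ e ∨ w ∈ e)
  have h4 : H.edgeFinset.filter (fun e => ¬ (v ∈ e ∨ w ∈ e)) = H.edgeFinset.filter (fun e => v ∉ e ∧ w ∉ e) := by
    ext e
    simp only [mem_filter, not_or]
  rw [h4] at h3
  rw [deg_eq_card_incidenceFinset, deg_eq_card_incidenceFinset]
  unfold nonIncident
  rw [h2] at h1
  omega

/-- The ordered adjacent pairs counted with `r + 1`: `Σ_{(v,w)} (d(v) + d(w) + nonIncident(v, w)) = 2 r (r + 1)`. -/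
theorem sum_adjPairsAll_nonIncident_eq (H : SimpleGraph V) [DecidableRel H.Adj] :
    ∑ p ∈ adjPairsAll H, (deg H p.1 + deg H p.2) + ∑ p ∈ adjPairsAll H, nonIncident H p.1 p.2 =
      2 * H.edgeFinset.card * (H.edgeFinset.card + 1) := by
  rw [← sum_add_distrib]
  rw [sum_congr rfl (fun p hp => deg_add_deg_add_nonIncident H ((mem_adjPairsAll H p).mp hp))]
  rw [sum_const, smul_eq_mul, card_adjPairsAll]

/-- In a triangle-free graph, an edge `x y` off `v₀` contains at most one neighbour of `v₀`: at least `Δ − 1`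
of the edges at `v₀` nonIncident both `x` and `y`. -/
theorem card_nbrs_off_edge_tf (H : SimpleGraph V) [DecidableRel H.Adj] (hfree : H.CliqueFree 3) (v₀ : V)
    {x y : V} (hxy : H.Adj x y) :
    deg H v₀ ≤ ((univ.filter (fun u => H.Adj v₀ u)).filter (fun u => u ≠ x ∧ u ≠ y)).card + 1 := by
  unfold deg
  have hsub : (univ.filter (fun u => H.Adj v₀ u)).filter (fun u => ¬ (u ≠ x ∧ u ≠ y)) ⊆ {x, y} := by
    intro u hu
    rw [mem_filter] at hu
    simp only [mem_insert, mem_singleton]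
    tauto
  have hcard := card_filter_add_card_filter_not (s := univ.filter (fun u => H.Adj v₀ u)) (fun u => u ≠ x ∧ u ≠ y)
  -- not both `x` and `y` are neighbours of `v₀`
  have hnot : ¬ (H.Adj v₀ x ∧ H.Adj v₀ y) := fun h =>
    hfree {v₀, x, y} (SimpleGraph.is3Clique_triple_iff.mpr ⟨h.1, h.2, hxy⟩)
  have hle : ((univ.filter (fun u => H.Adj v₀ u)).filter (fun u => ¬ (u ≠ x ∧ u ≠ y))).card ≤ 1 := by
    by_contra hcon
    obtain ⟨a, ha, b, hb, hab⟩ := one_lt_card.mp (not_le.mp hcon)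
    have ha' := hsub ha
    have hb' := hsub hb
    simp only [mem_insert, mem_singleton] at ha' hb'
    rw [mem_filter, mem_filter] at ha hb
    apply hnot
    rcases ha' with rfl | rfl <;> rcases hb' with rfl | rfl
    · exact absurd rfl hab
    · exact ⟨ha.1.2, hb.1.2⟩
    · exact ⟨hb.1.2, ha.1.2⟩
    · exact absurd rfl hab
  omega

/-- **AN EDGE OFF `v₀` AVOIDS AT LEAST `Δ − 1` EDGES AT `v₀`:** `nonIncident(x, y) + 1 ≥ d(v₀)` for an edge `x y` with
`x, y ≠ v₀`. -/
theorem nonIncident_ge_of_off (H : SimpleGraph V) [DecidableRel H.Adj] (hfree : H.CliqueFree 3) (v₀ : V)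
    {x y : V} (hxy : H.Adj x y) (hx : x ≠ v₀) (hy : y ≠ v₀) : deg H v₀ ≤ nonIncident H x y + 1 := by
  have h1 := card_nbrs_off_edge_tf H hfree v₀ hxy
  -- the map `u ↦ s(v₀, u)` sends the neighbours of `v₀` off `{x, y}` injectively into the avoiding edges
  have h2 : ((univ.filter (fun u => H.Adj v₀ u)).filter (fun u => u ≠ x ∧ u ≠ y)).card ≤ nonIncident H x y := by
    unfold nonIncident
    apply card_le_card_of_injOn (fun u => s(v₀, u))
    · intro u hu
      rw [mem_coe, mem_filter, mem_filter] at hu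
      rw [mem_coe, mem_filter, SimpleGraph.mem_edgeFinset, SimpleGraph.mem_edgeSet, Sym2.mem_iff, Sym2.mem_iff]
      refine ⟨hu.1.2, ?_, ?_⟩
      · rintro (h | h)
        · exact hx h
        · exact hu.2.1 h.symm
      · rintro (h | h)
        · exact hy h
        · exact hu.2.2 h.symm
    · intro a _ b _ hab
      have := Sym2.eq_iff.mp hab
      rcases this with ⟨-, h⟩ | ⟨h1, h2⟩
      · exact h
      · exact h2.trans h1
  omega

/-- **THE SUM OVER THE PAIRS AT `v₀`:** `Σ_{u ∼ v₀} nonIncident(v₀, u) ≥ s (Δ − 1)` where `s` is the number of edges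
off `v₀` (each of them avoids at least `Δ − 1` neighbours of `v₀`). -/
theorem sum_nonIncident_at_ge (H : SimpleGraph V) [DecidableRel H.Adj] (hfree : H.CliqueFree 3) (v₀ : V) :
    (H.edgeFinset.filter (fun e => v₀ ∉ e)).card * (deg H v₀ - 1) ≤
      ∑ u ∈ univ.filter (fun u => H.Adj v₀ u), nonIncident H v₀ u := by
  -- `nonIncident v₀ u = Σ_{e ∈ E, v₀ ∉ e} [u ∉ e]`
  have h1 : ∀ u, nonIncident H v₀ u = ∑ e ∈ H.edgeFinset.filter (fun e => v₀ ∉ e), (if u ∉ e then 1 else 0) := by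
    intro u
    unfold nonIncident
    rw [card_filter, sum_filter]
    apply sum_congr rfl
    intro e _
    by_cases h0 : v₀ ∈ e <;> by_cases hu : u ∈ e <;> simp [h0, hu]
  rw [sum_congr rfl (fun u _ => h1 u), sum_comm]
  -- for each edge `e` off `v₀`, the neighbours of `v₀` off `e` number at least `Δ − 1`
  have h2 : ∀ e ∈ H.edgeFinset.filter (fun e => v₀ ∉ e),
      deg H v₀ - 1 ≤ ∑ u ∈ univ.filter (fun u => H.Adj v₀ u), (if u ∉ e then 1 else 0) := by
    intro e he
    rw [mem_filter] at he
    revert he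
    refine Sym2.ind (fun x y he => ?_) e
    have hxy : H.Adj x y := by
      have := he.1
      rwa [SimpleGraph.mem_edgeFinset, SimpleGraph.mem_edgeSet] at this
    have h3 := card_nbrs_off_edge_tf H hfree v₀ hxy
    have h4 : ((univ.filter (fun u => H.Adj v₀ u)).filter (fun u => u ≠ x ∧ u ≠ y)).card =
        ∑ u ∈ univ.filter (fun u => H.Adj v₀ u), (if u ∉ s(x, y) then 1 else 0) := by
      rw [card_filter]
      apply sum_congr rfl
      intro u _
      simp only [Sym2.mem_iff, not_or]
    omega
  calc (H.edgeFinset.filter (fun e => v₀ ∉ e)).card * (deg H v₀ - 1)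
      = ∑ e ∈ H.edgeFinset.filter (fun e => v₀ ∉ e), (deg H v₀ - 1) := by rw [sum_const, smul_eq_mul]
    _ ≤ _ := sum_le_sum h2

/-- The ordered adjacent pairs off `v₀` number `2 s`, `s` the edges off `v₀`. -/
theorem card_adjPairs_off_vertex (H : SimpleGraph V) [DecidableRel H.Adj] (v₀ : V) :
    ((adjPairsAll H).filter (fun p => p.1 ≠ v₀ ∧ p.2 ≠ v₀)).card + 2 * deg H v₀ = 2 * H.edgeFinset.card := by
  have hsplit := card_filter_add_card_filter_not (s := adjPairsAll H) (fun p : V × V => p.1 ≠ v₀ ∧ p.2 ≠ v₀)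
  rw [card_adjPairsAll] at hsplit
  -- the pairs at `v₀`: `(v₀, u)` and `(u, v₀)` for `u ∼ v₀`
  have hat : ((adjPairsAll H).filter (fun p : V × V => ¬ (p.1 ≠ v₀ ∧ p.2 ≠ v₀))).card = 2 * deg H v₀ := by
    have hdisj : Disjoint ((univ.filter (fun u => H.Adj v₀ u)).image (fun u => (v₀, u)))
        ((univ.filter (fun u => H.Adj v₀ u)).image (fun u => (u, v₀))) := by
      rw [disjoint_left]
      intro p hp hp'
      rw [mem_image] at hp hp'
      obtain ⟨u, hu, rfl⟩ := hp
      obtain ⟨u', hu', h⟩ := hp'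
      rw [mem_filter] at hu
      have := (Prod.mk.inj h).1
      rw [this] at hu'
      rw [mem_filter] at hu'
      exact H.irrefl hu'.2
    have heq : (adjPairsAll H).filter (fun p : V × V => ¬ (p.1 ≠ v₀ ∧ p.2 ≠ v₀)) =
        (univ.filter (fun u => H.Adj v₀ u)).image (fun u => (v₀, u)) ∪
          (univ.filter (fun u => H.Adj v₀ u)).image (fun u => (u, v₀)) := by
      ext p
      rw [mem_filter, mem_adjPairsAll, mem_union, mem_image, mem_image]
      constructor
      · rintro ⟨hadj, hnot⟩
        push Not at hnot
        by_cases h1 : p.1 = v₀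
        · left
          exact ⟨p.2, mem_filter.mpr ⟨mem_univ _, h1 ▸ hadj⟩, by rw [← h1]⟩
        · right
          have h2 := hnot h1
          exact ⟨p.1, mem_filter.mpr ⟨mem_univ _, h2 ▸ H.adj_symm hadj⟩, by rw [← h2]⟩
      · rintro (⟨u, hu, rfl⟩ | ⟨u, hu, rfl⟩)
        · rw [mem_filter] at hu
          exact ⟨hu.2, fun h => h.1 rfl⟩
        · rw [mem_filter] at hu
          exact ⟨H.adj_symm hu.2, fun h => h.2 rfl⟩
    rw [heq, card_union_of_disjoint hdisj, card_image_of_injective _ (fun a b h => (Prod.mk.inj h).2),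
      card_image_of_injective _ (fun a b h => (Prod.mk.inj h).1)]
    unfold deg
    ring
  omega

/-- The ordered adjacent pairs at `v₀` carry `Σ nonIncident = 2 Σ_{u ∼ v₀} nonIncident(v₀, u)`. -/
theorem sum_nonIncident_at_eq (H : SimpleGraph V) [DecidableRel H.Adj] (v₀ : V) :
    ∑ p ∈ (adjPairsAll H).filter (fun p : V × V => ¬ (p.1 ≠ v₀ ∧ p.2 ≠ v₀)), nonIncident H p.1 p.2 =
      2 * ∑ u ∈ univ.filter (fun u => H.Adj v₀ u), nonIncident H v₀ u := by
  have hdisj : Disjoint ((univ.filter (fun u => H.Adj v₀ u)).image (fun u => (v₀, u)))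
      ((univ.filter (fun u => H.Adj v₀ u)).image (fun u => (u, v₀))) := by
    rw [disjoint_left]
    intro p hp hp'
    rw [mem_image] at hp hp'
    obtain ⟨u, hu, rfl⟩ := hp
    obtain ⟨u', hu', h⟩ := hp'
    rw [mem_filter] at hu
    have := (Prod.mk.inj h).1
    rw [this] at hu'
    rw [mem_filter] at hu'
    exact H.irrefl hu'.2
  have heq : (adjPairsAll H).filter (fun p : V × V => ¬ (p.1 ≠ v₀ ∧ p.2 ≠ v₀)) =
      (univ.filter (fun u => H.Adj v₀ u)).image (fun u => (v₀, u)) ∪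
        (univ.filter (fun u => H.Adj v₀ u)).image (fun u => (u, v₀)) := by
    ext p
    rw [mem_filter, mem_adjPairsAll, mem_union, mem_image, mem_image]
    constructor
    · rintro ⟨hadj, hnot⟩
      push Not at hnot
      by_cases h1 : p.1 = v₀
      · left
        exact ⟨p.2, mem_filter.mpr ⟨mem_univ _, h1 ▸ hadj⟩, by rw [← h1]⟩
      · right
        have h2 := hnot h1
        exact ⟨p.1, mem_filter.mpr ⟨mem_univ _, h2 ▸ H.adj_symm hadj⟩, by rw [← h2]⟩
    · rintro (⟨u, hu, rfl⟩ | ⟨u, hu, rfl⟩)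
      · rw [mem_filter] at hu
        exact ⟨hu.2, fun h => h.1 rfl⟩
      · rw [mem_filter] at hu
        exact ⟨H.adj_symm hu.2, fun h => h.2 rfl⟩
  rw [heq, sum_union hdisj, sum_image (fun a _ b _ h => (Prod.mk.inj h).2),
    sum_image (fun a _ b _ h => (Prod.mk.inj h).1)]
  have hc : (∑ u ∈ univ.filter (fun u => H.Adj v₀ u), nonIncident H u v₀) =
      ∑ u ∈ univ.filter (fun u => H.Adj v₀ u), nonIncident H v₀ u :=
    sum_congr rfl (fun u _ => nonIncident_comm H u v₀)
  rw [hc]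
  ring

end C047

end TriangleCap

end PercRepro
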